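/-
Copyright (c) 2026 the pub-hodgecm-mathlib formalisation cell (harness21).  Prover seat hodgecm-mathlib-K2E3-p37 (g3), Track B «K2-LIT»,
#184♮ = hLiu418 = `stmt-HodgeConjecture-24832`; socket #41 `sig_K2LiuSiegelEisensteinContinuation`, KIND W, brick (iii-fin-Φ5) FILE 2: the guarded Φ5 letters `hsd` of
★ `K2LiuKindWFiniteLetterOfReading.hFfin_of_reading'` (ED. 2) over the (KW-fac) reading (LEAD F0P6-plan (g15) BATCH #183 (4); KW desk F0P2-p08 (g3) ruling 00:28:58Z).
THEOREMS ONLY (no `def`, no `instance`, no notation, no named-fact hypothesis, no `sorry`).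
-/
import Summits.HodgeConjecture.HodgeConjecture.Theorems.K2LiuKindWFiniteStabilityLetters   -- ★ FILE 1 (this seat, p864084): `exists_setIntegral_kindWLocalBall_stable_and_differentiable` (+ ★ (iii-fin-read), ★ (x-a-int-fac), ★ (E6′), ★ `differentiable_siegelDeltaCharacter`)
import HarnessLib

/-!
# Crux `HLiu418`, socket #41, KIND W — brick (iii-fin-Φ5) FILE 2 `K2LiuKindWFiniteStabilityLettersOfReading`: THE LETTER `hsd` OF ★ `hFfin_of_reading'` (ED. 2, det guard)
# FOR THE (KW-fac) READING — from level ∕ holomorphy letters, and with those letters DISCHARGED for a standard Iwasawa datum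

Cell `hodgecm-mathlib`, crux item hLiu418 = `stmt-HodgeConjecture-24832` (helper lane `--supports … --as helper`, count-neutral), route of record
`HCCMUnconditional`; squad K2 ∕ K2Liu, road `K2_Liu`, socket #41, KIND W; KW desk of record F0P2-p08 (g3 → g4).  ★ `hFfin_of_reading'` (F0P2-p08, ED. 2 of ★ p863564) reads
`Ffin := if det ↑S = 0 then 0 else kindWFfin …` and takes BY VALUE the guarded per-place Φ5 letters
`hsd : ∀ j S h (v ∈ kindWFinset T₀ ↑S h), det ↑S ≠ 0 → ∃ K : ℕ, hstable ∧ hdiff` (the `kindWLocalBall`-integrals of `conj ψ_S(ι_v y)·FvT j S h v s ((w_Δ)_v·y·h_v)` at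
`ϖ_v := HeckeCharacter.uniformizer L⁺ v` are stable beyond `K` for EVERY `s`, and the stable one is entire).  THIS FILE pays `hsd` over the (KW-fac) reading `hread` of the local
factors (★ p863446's bytes: flat twists `H_v^{2(s−s₀)}·b_{j,v}` above `S₀`, the spherical `Λ_{s,v}` off `S₀`):
* §1 **`differentiable_lambdaLoc_apply`** — `s ↦ Λ_{s,v}(g)` is entire (★ `differentiable_siegelDeltaCharacter`; the decomposition `g = p·k` chosen by ★ Lit `LambdaLoc` does not
  involve `s`).
* §2 **`hsd_of_level_of_det_ne_zero`** (the dealt name) — `hsd` VERBATIM from two letters per factor: ONE open level `hlev : ∃ U, IsOpen ↑U ∧ ∀ s g k, k ∈ U → FvT … s (g·k) = FvT … s g`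
  (★ (ρ7) ∕ ★ Φ5 currency «=») and pointwise holomorphy `hdiffp` — ★ FILE 1's head with `g₀ := h_v`, the Siegel law by ★ (x-a-int-fac) `kindWFvT_mem_localDegPS`;
  **`level_and_holomorphy_letters_of_isStd`** — both letters DISCHARGED for a STANDARD datum `𝒦` (`h𝒦`): on `S₀`, `U := U_b ⊓ ι_v⁻¹(𝒦.K)` (smoothness of `b_{j,v}` = the flat
  family at `s₀`, ★ (E6′) `heightLoc_mul_of_mem` ∕ `isOpen_coe_comap_locToAdelic`) and ★ `differentiable_heightTwist` (`H_v > 0`, ★ Lit `modDelta_pos`); off `S₀`, `U := K_{H,v}`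
  (★ Lit `lambdaLoc_mul_localInt`) and §1 — quantitative principal-level twin: ★ `K2LiuKindWFactorLevelInvariance.exists_levels_forall_FvT_mul_eq` (K2E3-p26);
  **`hsd_of_isStd_of_det_ne_zero`** — `hsd` with NO letter beyond `h𝒦` and the (KW-fac) reading.
[KudlaRallis1994, §2] [Shimura1997, §18.3–18.4] [Casselman1980, §3] [HarrisKudlaSweet1996, §1 (1.15)] [Li1992, §3].
HONEST LABEL.  Count-neutral helper; closes no socket by itself: `HC_CM` is proved only modulo the 7 printed citations (2 remaining named inputs:
hLiu418 = `stmt-HodgeConjecture-24832`, h413 = `stmt-HodgeConjecture-24833`) until rung 0 closes.  NOT HERE: the singular indices `det S = 0` (read as `0` by ED. 2); the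
QUANTITATIVE radius `R ≤ Σ_w(ρ + a₁·lev + a₂·dS + a₃·dA)` of (KW-fin-stab) (K2E3-p06 (g7)) — this file's `∃ K` is the qualitative twin.

## References
* [KudlaRallis1994] S. Kudla, S. Rallis, Ann. of Math. 140 (1994): §2.   * [Shimura1997] G. Shimura, CBMS 93 (1997): §18.3–18.4.
* [Casselman1980] W. Casselman, Compositio Math. 40 (1980): §3.   * [HarrisKudlaSweet1996] M. Harris, S. Kudla, W. Sweet, J. AMS 9 (1996): §1 (1.15).
* [Li1992] J.-S. Li, J. reine angew. Math. 428 (1992): §3 (the unramified section).   * [Tan1999] V. Tan, Canad. J. Math. 51 (1999): §1 p. 166.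
-/

set_option autoImplicit false
-- the mandated namespace repeats the single-problem summit's segment (`HodgeConjecture.HodgeConjecture`)
set_option linter.dupNamespace false

noncomputable section

open scoped Matrix ComplexConjugate NNReal ENNReal Topology
open NumberField IsDedekindDomain Matrix MeasureTheory Measure Set Filter
open Literature.NumberTheory.Automorphic hiding IsKFinite
open Literature.NumberTheory.Automorphic.UnitaryGroup Literature.NumberTheory.GaloisRepresentations
open Literature.NumberTheory.LFunctions
open Literature.NumberTheory.GelbartRogawski1991 Literature.NumberTheory.GelbartRogawski1991.GRConstruction
open Literature.NumberTheory.GelbartRogawski1991.AdaptedBlocks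
open Literature.NumberTheory.GelbartRogawski1991.UnitaryDualPair Literature.NumberTheory.GelbartRogawski1991.UnitaryDualPair.LocalSplitting
open Literature.NumberTheory.K2Lit Literature.NumberTheory.K2Lit.SiegelDoubled Literature.NumberTheory.K2Lit.LocalSiegelDoubled Literature.NumberTheory.K2Lit.PlaceSplitting
open Summit.HodgeConjecture.HodgeConjecture.Cruxes.HLiu418.K2LiuSiegelUnipotentFourierDefs
open Summit.HodgeConjecture.HodgeConjecture.Cruxes.HLiu418.K2LiuSiegelUnipotentLocalDefs
open Summit.HodgeConjecture.HodgeConjecture.Cruxes.HLiu418.K2LiuSiegelUnipotentSplitDefs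
open Summit.HodgeConjecture.HodgeConjecture.Cruxes.HLiu418.K2LiuSiegelEisensteinKindWLetters
open Summit.HodgeConjecture.HodgeConjecture.Cruxes.HLiu418.K2LiuStdFamilyAwayPurityFlat (heightLoc_mul_of_mem isOpen_coe_comap_locToAdelic differentiable_heightTwist)
open Summit.HodgeConjecture.HodgeConjecture.Cruxes.HLiu418.K2LiuRankOneCentreContinuation (differentiable_siegelDeltaCharacter)
open Summit.HodgeConjecture.HodgeConjecture.Cruxes.HLiu418.K2LiuKindWFactorLetters (kindWFvT_mem_localDegPS)
open Summit.HodgeConjecture.HodgeConjecture.Cruxes.HLiu418.K2LiuKindWFiniteLetterDefs (kindWLocalBall)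

namespace Summit.HodgeConjecture.HodgeConjecture.Cruxes.HLiu418.K2LiuKindWFiniteStabilityLettersOfReading

open Summit.HodgeConjecture.HodgeConjecture.Cruxes.HLiu418.K2LiuKindWFiniteStabilityLetters (exists_setIntegral_kindWLocalBall_stable_and_differentiable)

variable (L : Type) [Field L] [NumberField L] [IsCMField L]
variable {N M : ℕ} (e : Fin N × Fin M ≃ Fin 2)
  (dV : Fin N → L) (hdV : ∀ i, IsCMField.complexConj L (dV i) = dV i)
  (dW : Fin M → L) (hdW : ∀ i, IsCMField.complexConj L (dW i) = dW i)
  (hdV0 : ∀ i, dV i ≠ 0) (hdW0 : ∀ i, dW i ≠ 0)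

/-! ## §1 `s ↦ Λ_{s,v}(g)` is entire -/

/-- **`s ↦ Λ_{s,v}(g)` IS ENTIRE** for every `g ∈ H(L⁺_v)`: on `P_Δ·K_H` it is `s ↦ δ_{χ,s}(ι_v p)` for the chosen decomposition `g = p k` (the choice does not involve `s`;
★ `differentiable_siegelDeltaCharacter`), off it the junk constant `0` (★ Lit `lambdaLoc_eq_zero`). [cite: KudlaRallis1994, §1] [cite: Li1992, §3] -/
theorem differentiable_lambdaLoc_apply (v : HeightOneSpectrum (𝓞 (Fp L))) (χ : HeckeCharacter L)
    (g : UnitaryGroup.localPi L (IsCMField.complexConj L) (2 + 2) (hermD L e dV hdV dW hdW) v) :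
    Differentiable ℂ fun s : ℂ => LambdaLoc L e dV hdV dW hdW v χ s g := by
  classical
  by_cases hh : ∃ pk, IsSiegelIntDecomp L e dV hdV dW hdW v g pk
  · have hfun : (fun s : ℂ => LambdaLoc L e dV hdV dW hdW v χ s g) =
        fun s : ℂ => siegelDeltaCharacter L e dV hdV dW hdW χ s (locToAdelic L e dV hdV dW hdW v (Classical.choose hh).1) := by
      refine funext fun s => ?_
      rw [LambdaLoc, dif_pos hh, siegelCharLoc_apply]
    rw [hfun]
    exact differentiable_siegelDeltaCharacter L e dV hdV dW hdW χ _
  · have hfun : (fun s : ℂ => LambdaLoc L e dV hdV dW hdW v χ s g) = fun _ => 0 := funext fun s => lambdaLoc_eq_zero L e dV hdV dW hdW v χ s hh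
    rw [hfun]
    exact differentiable_const 0

/-! ## §2 The guarded Φ5 letters `hsd` of ★ `hFfin_of_reading'` for the (KW-fac) reading -/

section Reading

variable [DecidableEq (HeightOneSpectrum (𝓞 (Fp L)))]
  [∀ v : HeightOneSpectrum (𝓞 (Fp L)), MeasurableSpace ↥(unipDeltaLoc L e dV hdV dW hdW v)]
  [∀ v : HeightOneSpectrum (𝓞 (Fp L)), BorelSpace ↥(unipDeltaLoc L e dV hdV dW hdW v)]
  (T₀ : Finset (HeightOneSpectrum (𝓞 (Fp L))))
  (νv : ∀ v : HeightOneSpectrum (𝓞 (Fp L)), Measure ↥(unipDeltaLoc L e dV hdV dW hdW v)) [∀ v, (νv v).IsHaarMeasure]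
  {χ : HeckeCharacter L} (𝒦 : IwasawaDatum L e dV hdV dW hdW) (s₀ : ℂ)
  {S₀ : Finset (HeightOneSpectrum (𝓞 (Fp L)))} (hχS₀ : ∀ v, v ∉ S₀ → ∀ w : UnitaryGroup.PlacesOver L v, χ.IsUnramifiedAt w.1)
  {m : ℕ} (b : Fin m → (v : HeightOneSpectrum (𝓞 (Fp L))) → (UnitaryGroup.localPi L (IsCMField.complexConj L) (2 + 2) (hermD L e dV hdV dW hdW) v → ℂ))
  (hb : ∀ i, ∀ v ∈ S₀, ∀ s : ℂ, (fun u => ((modDelta L e dV hdV dW hdW (𝒦.pPart (locToAdelic L e dV hdV dW hdW v u)) : ℝ) : ℂ) ^ (2 * (s - s₀)) * b i v u) ∈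
    localDegPS (Fp L) L (IsCMField.complexConj L) (complexConj_imagUnit L) (imagUnit_ne_zero L) (imagUnit_mul_self L)
      v 2 (gramR_isSymm L e dV hdV dW hdW) (hermD_eq_map_gramD L e dV hdV dW hdW) (fun w => χ.localComponent w.1) s)
  (FvT : Fin m → ∀ (S : skewMatrices ((IsCMField.complexConj L : L ≃ₐ[Fp L] L) : L →+* L) ((gramR L e dV hdV dW hdW).map (algebraMap (Fp L) L)))
    (h : HA L e dV hdV dW hdW) (v : (kindWFinset L e dV hdV dW hdW T₀ (S : Matrix (Fin 2) (Fin 2) L) h)),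
    ℂ → UnitaryGroup.localPi L (IsCMField.complexConj L) (2 + 2) (hermD L e dV hdV dW hdW) v.1 → ℂ)
  (hread : ∀ (j : Fin m) (S : skewMatrices ((IsCMField.complexConj L : L ≃ₐ[Fp L] L) : L →+* L) ((gramR L e dV hdV dW hdW).map (algebraMap (Fp L) L)))
    (h : HA L e dV hdV dW hdW) (v : (kindWFinset L e dV hdV dW hdW T₀ (S : Matrix (Fin 2) (Fin 2) L) h)) (s : ℂ)
    (y : UnitaryGroup.localPi L (IsCMField.complexConj L) (2 + 2) (hermD L e dV hdV dW hdW) v.1),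
    FvT j S h v s y = if v.1 ∈ S₀ then ((modDelta L e dV hdV dW hdW (𝒦.pPart (locToAdelic L e dV hdV dW hdW v.1 y)) : ℝ) : ℂ) ^ (2 * (s - s₀)) * b j v.1 y
      else LambdaLoc L e dV hdV dW hdW v.1 χ s y)

include hdV0 hdW0 hχS₀ hb hread in
set_option maxHeartbeats 800000 in -- MEASURED: 400 000 ✗ (`whnf` of ★ ED. 2's dependent `hsd` block) ∕ 800 000 ✓ (the class of ★ `hFfin_of_reading'`); scoped 4×, plain `intro`∕`exact`, no search tactics
/-- **`hsd` OF ★ `hFfin_of_reading'` (ED. 2, det guard) FROM THE LEVEL ∕ HOLOMORPHY LETTERS OF THE FACTORS.**  For the (KW-fac) reading `hread` of the local factors (so each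
`FvT j S h v s` is a Siegel section of `I_v(s, χ_v)`, ★ (x-a-int-fac) `kindWFvT_mem_localDegPS`), granted per `(j, S, h, v)` ONE open level (`hlev`, ★ (ρ7) ∕ ★ Φ5 currency
`f s (g k) = f s g`) and pointwise holomorphy in `s` (`hdiffp`):  at every `v ∈ kindWFinset T₀ ↑S h` with `det ↑S ≠ 0` the `kindWLocalBall`-integrals of
`conj ψ_S(ι_v y)·FvT j S h v s ((w_Δ)_v·y·h_v)` at the uniformisers `ϖ_v := HeckeCharacter.uniformizer L⁺ v` are STABLE beyond one exponent `K` for EVERY `s`, and the stable one is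
ENTIRE (`exists_setIntegral_kindWLocalBall_stable_and_differentiable` with `g₀ := h_v`). [cite: Casselman1980, §3] [cite: KudlaRallis1994, §2] [cite: Shimura1997, §18.3–18.4] -/
theorem hsd_of_level_of_det_ne_zero
    (hlev : ∀ (j : Fin m) (S : skewMatrices ((IsCMField.complexConj L : L ≃ₐ[Fp L] L) : L →+* L) ((gramR L e dV hdV dW hdW).map (algebraMap (Fp L) L)))
      (h : HA L e dV hdV dW hdW) (v : (kindWFinset L e dV hdV dW hdW T₀ (S : Matrix (Fin 2) (Fin 2) L) h)),
      ∃ U : Subgroup (UnitaryGroup.localPi L (IsCMField.complexConj L) (2 + 2) (hermD L e dV hdV dW hdW) v.1),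
        IsOpen (U : Set (UnitaryGroup.localPi L (IsCMField.complexConj L) (2 + 2) (hermD L e dV hdV dW hdW) v.1)) ∧
          ∀ (s : ℂ) (g k : UnitaryGroup.localPi L (IsCMField.complexConj L) (2 + 2) (hermD L e dV hdV dW hdW) v.1), k ∈ U → FvT j S h v s (g * k) = FvT j S h v s g)
    (hdiffp : ∀ (j : Fin m) (S : skewMatrices ((IsCMField.complexConj L : L ≃ₐ[Fp L] L) : L →+* L) ((gramR L e dV hdV dW hdW).map (algebraMap (Fp L) L)))
      (h : HA L e dV hdV dW hdW) (v : (kindWFinset L e dV hdV dW hdW T₀ (S : Matrix (Fin 2) (Fin 2) L) h))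
      (y : UnitaryGroup.localPi L (IsCMField.complexConj L) (2 + 2) (hermD L e dV hdV dW hdW) v.1), Differentiable ℂ fun s : ℂ => FvT j S h v s y) :
    ∀ (j : Fin m) (S : skewMatrices ((IsCMField.complexConj L : L ≃ₐ[Fp L] L) : L →+* L) ((gramR L e dV hdV dW hdW).map (algebraMap (Fp L) L)))
      (h : HA L e dV hdV dW hdW) (v : (kindWFinset L e dV hdV dW hdW T₀ (S : Matrix (Fin 2) (Fin 2) L) h)), (S : Matrix (Fin 2) (Fin 2) L).det ≠ 0 → ∃ K : ℕ,
      (∀ (s : ℂ) (k : ℕ), K ≤ k →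
      ∫ y in kindWLocalBall L e dV hdV dW hdW v.1 ((fun v => (HeckeCharacter.uniformizer (Fp L) v : v.adicCompletion (Fp L))) v.1) (-(k : ℤ)),
        conj (unipDeltaChar L e dV hdV dW hdW (S : Matrix (Fin 2) (Fin 2) L)
            (locToAdelic L e dV hdV dW hdW v.1
              ((y : ↥(unipDeltaLoc L e dV hdV dW hdW v.1)) : UnitaryGroup.localPi L (IsCMField.complexConj L) (2 + 2) (hermD L e dV hdV dW hdW) v.1)) : ℂ) *
          FvT j S h v s (UnitaryGroup.evalPlace (Fp L) L (IsCMField.complexConj L) (2 + 2) (hermD L e dV hdV dW hdW) v.1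
                (UnitaryGroup.finPart (Fp L) L (IsCMField.complexConj L) (2 + 2) (hermD L e dV hdV dW hdW) (SiegelDoubled.weylDelta L e dV hdV dW hdW)) *
              ((y : ↥(unipDeltaLoc L e dV hdV dW hdW v.1)) : UnitaryGroup.localPi L (IsCMField.complexConj L) (2 + 2) (hermD L e dV hdV dW hdW) v.1) *
              UnitaryGroup.evalPlace (Fp L) L (IsCMField.complexConj L) (2 + 2) (hermD L e dV hdV dW hdW) v.1
                (UnitaryGroup.finPart (Fp L) L (IsCMField.complexConj L) (2 + 2) (hermD L e dV hdV dW hdW) h)) ∂(νv v.1) =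
      ∫ y in kindWLocalBall L e dV hdV dW hdW v.1 ((fun v => (HeckeCharacter.uniformizer (Fp L) v : v.adicCompletion (Fp L))) v.1) (-(K : ℤ)),
        conj (unipDeltaChar L e dV hdV dW hdW (S : Matrix (Fin 2) (Fin 2) L)
            (locToAdelic L e dV hdV dW hdW v.1
              ((y : ↥(unipDeltaLoc L e dV hdV dW hdW v.1)) : UnitaryGroup.localPi L (IsCMField.complexConj L) (2 + 2) (hermD L e dV hdV dW hdW) v.1)) : ℂ) *
          FvT j S h v s (UnitaryGroup.evalPlace (Fp L) L (IsCMField.complexConj L) (2 + 2) (hermD L e dV hdV dW hdW) v.1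
                (UnitaryGroup.finPart (Fp L) L (IsCMField.complexConj L) (2 + 2) (hermD L e dV hdV dW hdW) (SiegelDoubled.weylDelta L e dV hdV dW hdW)) *
              ((y : ↥(unipDeltaLoc L e dV hdV dW hdW v.1)) : UnitaryGroup.localPi L (IsCMField.complexConj L) (2 + 2) (hermD L e dV hdV dW hdW) v.1) *
              UnitaryGroup.evalPlace (Fp L) L (IsCMField.complexConj L) (2 + 2) (hermD L e dV hdV dW hdW) v.1
                (UnitaryGroup.finPart (Fp L) L (IsCMField.complexConj L) (2 + 2) (hermD L e dV hdV dW hdW) h)) ∂(νv v.1)) ∧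
      (Differentiable ℂ fun s : ℂ =>
      ∫ y in kindWLocalBall L e dV hdV dW hdW v.1 ((fun v => (HeckeCharacter.uniformizer (Fp L) v : v.adicCompletion (Fp L))) v.1) (-(K : ℤ)),
        conj (unipDeltaChar L e dV hdV dW hdW (S : Matrix (Fin 2) (Fin 2) L)
            (locToAdelic L e dV hdV dW hdW v.1
              ((y : ↥(unipDeltaLoc L e dV hdV dW hdW v.1)) : UnitaryGroup.localPi L (IsCMField.complexConj L) (2 + 2) (hermD L e dV hdV dW hdW) v.1)) : ℂ) *
          FvT j S h v s (UnitaryGroup.evalPlace (Fp L) L (IsCMField.complexConj L) (2 + 2) (hermD L e dV hdV dW hdW) v.1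
                (UnitaryGroup.finPart (Fp L) L (IsCMField.complexConj L) (2 + 2) (hermD L e dV hdV dW hdW) (SiegelDoubled.weylDelta L e dV hdV dW hdW)) *
              ((y : ↥(unipDeltaLoc L e dV hdV dW hdW v.1)) : UnitaryGroup.localPi L (IsCMField.complexConj L) (2 + 2) (hermD L e dV hdV dW hdW) v.1) *
              UnitaryGroup.evalPlace (Fp L) L (IsCMField.complexConj L) (2 + 2) (hermD L e dV hdV dW hdW) v.1
                (UnitaryGroup.finPart (Fp L) L (IsCMField.complexConj L) (2 + 2) (hermD L e dV hdV dW hdW) h)) ∂(νv v.1)) := by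
  intro j S h v hdet
  obtain ⟨U, hU, hFU⟩ := hlev j S h v
  exact exists_setIntegral_kindWLocalBall_stable_and_differentiable L e dV hdV dW hdW hdV0 hdW0 v.1 (HeckeCharacter.valued_uniformizer (K := Fp L) v.1) (νv v.1) χ hU
    (fun s => ((mem_localDegPS_iff (Fp L) L (IsCMField.complexConj L) (complexConj_imagUnit L) (imagUnit_ne_zero L) (imagUnit_mul_self L) v.1 2
      (gramR_isSymm L e dV hdV dW hdW) (hermD_eq_map_gramD L e dV hdV dW hdW) _ s _).1 (kindWFvT_mem_localDegPS L e dV hdV dW hdW 𝒦 s₀ hχS₀ b hb FvT hread j S h v s)).1)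
    hFU (hdiffp j S h v) S hdet _

omit [∀ v : HeightOneSpectrum (𝓞 (Fp L)), MeasurableSpace ↥(unipDeltaLoc L e dV hdV dW hdW v)] [∀ v : HeightOneSpectrum (𝓞 (Fp L)), BorelSpace ↥(unipDeltaLoc L e dV hdV dW hdW v)] in
include hdV0 hdW0 hχS₀ hb hread in
set_option maxHeartbeats 400000 in -- MEASURED: 200 000 ✗ (`whnf` on ★ (KW-fac)'s dependent `hb` ∕ `hread` blocks) ∕ 400 000 ✓; scoped 2×, plain `rw`∕`exact`, no search tactics
/-- **THE LEVEL ∕ HOLOMORPHY LETTERS OF THE (KW-fac) FACTORS, DISCHARGED FOR A STANDARD DATUM.**  On `S₀` the factor is the flat twist `H_v^{2(s−s₀)}·b_{j,v}`: `b_{j,v}` is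
smooth (the flat family at `s₀`, ★ (KW-fac) `hb`) and the height `H_v = Φ_𝒦 ∘ ι_v` is right-invariant under the OPEN `ι_v⁻¹(𝒦.K)` (★ (E6′) `heightLoc_mul_of_mem`,
`isOpen_coe_comap_locToAdelic`), so `U := U_b ⊓ ι_v⁻¹(𝒦.K)` is one level for every `s`, and `s ↦ H_v(y)^{2(s−s₀)}·b(y)` is entire (`H_v > 0`, ★ `differentiable_heightTwist`);
off `S₀` it is `Λ_{s,v}`, right-`K_{H,v}`-invariant (★ Lit `lambdaLoc_mul_localInt`) and entire (§1).  (Quantitative principal-level twin: ★ `exists_levels_forall_FvT_mul_eq`.)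
[cite: HarrisKudlaSweet1996, §1 (1.15)] [cite: Tan1999, §1 p. 166] [cite: Li1992, §3] -/
theorem level_and_holomorphy_letters_of_isStd (h𝒦 : 𝒦.IsStd)
    (j : Fin m) (S : skewMatrices ((IsCMField.complexConj L : L ≃ₐ[Fp L] L) : L →+* L) ((gramR L e dV hdV dW hdW).map (algebraMap (Fp L) L)))
    (h : HA L e dV hdV dW hdW) (v : (kindWFinset L e dV hdV dW hdW T₀ (S : Matrix (Fin 2) (Fin 2) L) h)) :
    (∃ U : Subgroup (UnitaryGroup.localPi L (IsCMField.complexConj L) (2 + 2) (hermD L e dV hdV dW hdW) v.1),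
        IsOpen (U : Set (UnitaryGroup.localPi L (IsCMField.complexConj L) (2 + 2) (hermD L e dV hdV dW hdW) v.1)) ∧
          ∀ (s : ℂ) (g k : UnitaryGroup.localPi L (IsCMField.complexConj L) (2 + 2) (hermD L e dV hdV dW hdW) v.1), k ∈ U → FvT j S h v s (g * k) = FvT j S h v s g) ∧
      ∀ y : UnitaryGroup.localPi L (IsCMField.complexConj L) (2 + 2) (hermD L e dV hdV dW hdW) v.1, Differentiable ℂ fun s : ℂ => FvT j S h v s y := by
  by_cases hv : v.1 ∈ S₀
  · -- the flat twist of `b_{j,v}`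
    have hfun : ∀ s, FvT j S h v s = fun y => ((modDelta L e dV hdV dW hdW (𝒦.pPart (locToAdelic L e dV hdV dW hdW v.1 y)) : ℝ) : ℂ) ^ (2 * (s - s₀)) * b j v.1 y :=
      fun s => funext fun y => by rw [hread, if_pos hv]
    -- `b_{j,v}` is smooth: the flat family at `s₀` is `b_{j,v}` itself
    have hb₀ : (fun u => ((modDelta L e dV hdV dW hdW (𝒦.pPart (locToAdelic L e dV hdV dW hdW v.1 u)) : ℝ) : ℂ) ^ (2 * (s₀ - s₀)) * b j v.1 u) = b j v.1 :=
      funext fun u => by rw [sub_self, mul_zero, Complex.cpow_zero, one_mul]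
    have hsm : IsSmooth (Fp L) L (IsCMField.complexConj L) v.1 2 (JD := hermD L e dV hdV dW hdW) (b j v.1) := by
      have hmem := ((mem_localDegPS_iff (Fp L) L (IsCMField.complexConj L) (complexConj_imagUnit L) (imagUnit_ne_zero L) (imagUnit_mul_self L) v.1 2
        (gramR_isSymm L e dV hdV dW hdW) (hermD_eq_map_gramD L e dV hdV dW hdW) _ s₀ _).1 (hb j v.1 hv s₀)).2
      rwa [hb₀] at hmem
    obtain ⟨Ub, hUb⟩ := hsm
    refine ⟨⟨(Ub : Subgroup (UnitaryGroup.localPi L (IsCMField.complexConj L) (2 + 2) (hermD L e dV hdV dW hdW) v.1)) ⊓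
        (𝒦.K).comap (locToAdelic L e dV hdV dW hdW v.1), ?_, fun s g k hk => ?_⟩, fun y => ?_⟩
    · rw [Subgroup.coe_inf]
      exact Ub.isOpen.inter (isOpen_coe_comap_locToAdelic L e dV hdV dW hdW v.1 h𝒦)
    · obtain ⟨hkU, hkK⟩ := Subgroup.mem_inf.1 hk
      rw [hfun s]
      show ((modDelta L e dV hdV dW hdW (𝒦.pPart (locToAdelic L e dV hdV dW hdW v.1 (g * k))) : ℝ) : ℂ) ^ (2 * (s - s₀)) * b j v.1 (g * k) =
        ((modDelta L e dV hdV dW hdW (𝒦.pPart (locToAdelic L e dV hdV dW hdW v.1 g)) : ℝ) : ℂ) ^ (2 * (s - s₀)) * b j v.1 g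
      rw [hUb g k hkU, heightLoc_mul_of_mem L e dV hdV hdV0 dW hdW hdW0 v.1 𝒦 g (Subgroup.mem_comap.1 hkK)]
    · have hfun' : (fun s : ℂ => FvT j S h v s y) =
          fun s : ℂ => ((modDelta L e dV hdV dW hdW (𝒦.pPart (locToAdelic L e dV hdV dW hdW v.1 y)) : ℝ) : ℂ) ^ (2 * (s - s₀)) * b j v.1 y :=
        funext fun s => by rw [hread, if_pos hv]
      rw [hfun']
      exact differentiable_heightTwist (modDelta_pos L e dV hdV dW hdW _) s₀ (b j v.1 y)
  · -- the spherical section `Λ_{s,v}`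
    have hfun : ∀ s, FvT j S h v s = LambdaLoc L e dV hdV dW hdW v.1 χ s := fun s => funext fun y => by rw [hread, if_neg hv]
    refine ⟨⟨UnitaryGroup.localInt L (IsCMField.complexConj L) (2 + 2) (hermD L e dV hdV dW hdW) v.1,
      UnitaryGroup.isOpen_localInt L (IsCMField.complexConj L) (2 + 2) (hermD L e dV hdV dW hdW) v.1, fun s g k hk => ?_⟩, fun y => ?_⟩
    · rw [hfun s]
      exact lambdaLoc_mul_localInt L e dV hdV dW hdW v.1 χ s (hχS₀ v.1 hv) g hk
    · have hfun' : (fun s : ℂ => FvT j S h v s y) = fun s : ℂ => LambdaLoc L e dV hdV dW hdW v.1 χ s y := funext fun s => by rw [hread, if_neg hv]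
      rw [hfun']
      exact differentiable_lambdaLoc_apply L e dV hdV dW hdW v.1 χ y

include hdV0 hdW0 hχS₀ hb hread in
set_option maxHeartbeats 800000 in -- MEASURED: 400 000 ✗ (`whnf` of ★ ED. 2's dependent `hsd` block) ∕ 800 000 ✓ (the class of ★ `hFfin_of_reading'`); scoped 4×, plain `exact`, no search tactics
/-- **`hsd` OF ★ `hFfin_of_reading'` (ED. 2, det guard), NO FURTHER LETTER, FOR A STANDARD DATUM** — `hsd_of_level_of_det_ne_zero` with its level ∕ holomorphy letters paid by
`level_and_holomorphy_letters_of_isStd`.  With ★ `hFfin_of_reading'` this is ★ ED. 4's `hFfin` for `Ffin := if det ↑S = 0 then 0 else kindWFfin …` over the (KW-fac) reading.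
[cite: Casselman1980, §3] [cite: KudlaRallis1994, §2] [cite: Shimura1997, §18.3–18.4] -/
theorem hsd_of_isStd_of_det_ne_zero (h𝒦 : 𝒦.IsStd) :
    ∀ (j : Fin m) (S : skewMatrices ((IsCMField.complexConj L : L ≃ₐ[Fp L] L) : L →+* L) ((gramR L e dV hdV dW hdW).map (algebraMap (Fp L) L)))
      (h : HA L e dV hdV dW hdW) (v : (kindWFinset L e dV hdV dW hdW T₀ (S : Matrix (Fin 2) (Fin 2) L) h)), (S : Matrix (Fin 2) (Fin 2) L).det ≠ 0 → ∃ K : ℕ,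
      (∀ (s : ℂ) (k : ℕ), K ≤ k →
      ∫ y in kindWLocalBall L e dV hdV dW hdW v.1 ((fun v => (HeckeCharacter.uniformizer (Fp L) v : v.adicCompletion (Fp L))) v.1) (-(k : ℤ)),
        conj (unipDeltaChar L e dV hdV dW hdW (S : Matrix (Fin 2) (Fin 2) L)
            (locToAdelic L e dV hdV dW hdW v.1
              ((y : ↥(unipDeltaLoc L e dV hdV dW hdW v.1)) : UnitaryGroup.localPi L (IsCMField.complexConj L) (2 + 2) (hermD L e dV hdV dW hdW) v.1)) : ℂ) *
          FvT j S h v s (UnitaryGroup.evalPlace (Fp L) L (IsCMField.complexConj L) (2 + 2) (hermD L e dV hdV dW hdW) v.1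
                (UnitaryGroup.finPart (Fp L) L (IsCMField.complexConj L) (2 + 2) (hermD L e dV hdV dW hdW) (SiegelDoubled.weylDelta L e dV hdV dW hdW)) *
              ((y : ↥(unipDeltaLoc L e dV hdV dW hdW v.1)) : UnitaryGroup.localPi L (IsCMField.complexConj L) (2 + 2) (hermD L e dV hdV dW hdW) v.1) *
              UnitaryGroup.evalPlace (Fp L) L (IsCMField.complexConj L) (2 + 2) (hermD L e dV hdV dW hdW) v.1
                (UnitaryGroup.finPart (Fp L) L (IsCMField.complexConj L) (2 + 2) (hermD L e dV hdV dW hdW) h)) ∂(νv v.1) =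
      ∫ y in kindWLocalBall L e dV hdV dW hdW v.1 ((fun v => (HeckeCharacter.uniformizer (Fp L) v : v.adicCompletion (Fp L))) v.1) (-(K : ℤ)),
        conj (unipDeltaChar L e dV hdV dW hdW (S : Matrix (Fin 2) (Fin 2) L)
            (locToAdelic L e dV hdV dW hdW v.1
              ((y : ↥(unipDeltaLoc L e dV hdV dW hdW v.1)) : UnitaryGroup.localPi L (IsCMField.complexConj L) (2 + 2) (hermD L e dV hdV dW hdW) v.1)) : ℂ) *
          FvT j S h v s (UnitaryGroup.evalPlace (Fp L) L (IsCMField.complexConj L) (2 + 2) (hermD L e dV hdV dW hdW) v.1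
                (UnitaryGroup.finPart (Fp L) L (IsCMField.complexConj L) (2 + 2) (hermD L e dV hdV dW hdW) (SiegelDoubled.weylDelta L e dV hdV dW hdW)) *
              ((y : ↥(unipDeltaLoc L e dV hdV dW hdW v.1)) : UnitaryGroup.localPi L (IsCMField.complexConj L) (2 + 2) (hermD L e dV hdV dW hdW) v.1) *
              UnitaryGroup.evalPlace (Fp L) L (IsCMField.complexConj L) (2 + 2) (hermD L e dV hdV dW hdW) v.1
                (UnitaryGroup.finPart (Fp L) L (IsCMField.complexConj L) (2 + 2) (hermD L e dV hdV dW hdW) h)) ∂(νv v.1)) ∧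
      (Differentiable ℂ fun s : ℂ =>
      ∫ y in kindWLocalBall L e dV hdV dW hdW v.1 ((fun v => (HeckeCharacter.uniformizer (Fp L) v : v.adicCompletion (Fp L))) v.1) (-(K : ℤ)),
        conj (unipDeltaChar L e dV hdV dW hdW (S : Matrix (Fin 2) (Fin 2) L)
            (locToAdelic L e dV hdV dW hdW v.1
              ((y : ↥(unipDeltaLoc L e dV hdV dW hdW v.1)) : UnitaryGroup.localPi L (IsCMField.complexConj L) (2 + 2) (hermD L e dV hdV dW hdW) v.1)) : ℂ) *
          FvT j S h v s (UnitaryGroup.evalPlace (Fp L) L (IsCMField.complexConj L) (2 + 2) (hermD L e dV hdV dW hdW) v.1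
                (UnitaryGroup.finPart (Fp L) L (IsCMField.complexConj L) (2 + 2) (hermD L e dV hdV dW hdW) (SiegelDoubled.weylDelta L e dV hdV dW hdW)) *
              ((y : ↥(unipDeltaLoc L e dV hdV dW hdW v.1)) : UnitaryGroup.localPi L (IsCMField.complexConj L) (2 + 2) (hermD L e dV hdV dW hdW) v.1) *
              UnitaryGroup.evalPlace (Fp L) L (IsCMField.complexConj L) (2 + 2) (hermD L e dV hdV dW hdW) v.1
                (UnitaryGroup.finPart (Fp L) L (IsCMField.complexConj L) (2 + 2) (hermD L e dV hdV dW hdW) h)) ∂(νv v.1)) :=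
  hsd_of_level_of_det_ne_zero L e dV hdV dW hdW hdV0 hdW0 T₀ νv 𝒦 s₀ hχS₀ b hb FvT hread
    (fun j S h v => (level_and_holomorphy_letters_of_isStd L e dV hdV dW hdW hdV0 hdW0 T₀ 𝒦 s₀ hχS₀ b hb FvT hread h𝒦 j S h v).1)
    (fun j S h v => (level_and_holomorphy_letters_of_isStd L e dV hdV dW hdW hdV0 hdW0 T₀ 𝒦 s₀ hχS₀ b hb FvT hread h𝒦 j S h v).2)

end Reading

end Summit.HodgeConjecture.HodgeConjecture.Cruxes.HLiu418.K2LiuKindWFiniteStabilityLettersOfReading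

end
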